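import Literature.NumberTheory.Weil1964.ArchWeilContinuityKAK
import HarnessLib

/-!
# The vacuum-normalised implementer section of a `KAK` group on `𝓢(ℝ^σ)` (Folland 1989, §4.2 and Prop. 4.39)

Topic `NumberTheory/Weil1964`; namespace `Literature.NumberTheory.Weil1964`.  Continuation of
`Literature.NumberTheory.Weil1964.ArchWeilContinuityKAK`.

**The point of this file.**  `ArchWeilContinuityKAK` DERIVES strong continuity (w1) of a GIVEN representation
`ω : G → End 𝓢(ℝ^σ)` that is Heisenberg-covariant with unitary lifts.  Here no representation is given: from the
same abstract data — phase-space maps `γ : G → PhaseMap σ` compatible with multiplication, a "compact part"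
`κ : K → G` implemented by an explicit jointly continuous family `W_K` FIXING the Gaussian `h₀` (e.g. Folland's
`μ₀ = unitaryOpPi`), an explicit jointly continuous implementer family `W_A` over `a : P → G` whose vacuum
coefficients `⟪k₀, W_A(t) h₀⟫` do not vanish, and a proper surjection `(k₁, t, k₂) ↦ κ k₁ · a t · κ k₂` — we
CONSTRUCT a canonical family of operators

  `vacSection γ g : 𝓢(ℝ^σ) →L[ℂ] 𝓢(ℝ^σ)`,

the UNIQUE operator that is Heisenberg-covariant over `γ g` (Folland's (4.23)), is the restriction of a unitary
operator of `L²(ℝ^σ)`, and has POSITIVE vacuum coefficient `⟪k₀, toL2 (A h₀)⟫ > 0`.  Existence on `KAK` words is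
composition; uniqueness is Schur's lemma for the Heisenberg group (`eq_relCoeff_smul_of_liftsTo`: two implementers
of the same phase-space map differ by a unimodular scalar, which the vacuum normalisation pins).  The section is
NOT claimed to be a homomorphism (it is one only up to the metaplectic cocycle); what IS proved:

* §1 `vacCoeffS`, `vnormS`, `IsImplementerS` (one operator implementing one phase-space map, with a unitary lift)
  and their algebra: composition, unimodular rescaling, Schur `IsImplementerS.exists_eq_smul`;
* §2 the section: `vacSection`, **`vacSection_eq_vnormS`** (uniqueness: every implementer with non-zero vacuum
  coefficient normalises to it), `isImplementerS_vacSection`, `vacCoeffS_vacSection` (the coefficient is the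
  positive real `‖⟪k₀, A h₀⟫‖`), `eq_vacSection` (characterisation), `vacSection_apply_ne_zero`;
* §3 under the `KAK` data: `exists_isImplementerS_of_kak` (existence everywhere), **`vacSection_kak`** (the
  explicit formula on words: a continuous unimodular scalar times `W_K k₁ ∘ W_A t ∘ W_K k₂`),
  **`continuous_uncurry_vacSection`** — `(g, f) ↦ vacSection γ g f` is jointly continuous `G × 𝓢 → 𝓢` (descent along
  the proper surjection, `continuous_uncurry_of_isProperMap`), `continuous_apply_vacSection`,
  `isPhaseCovariantS_vacSection`, `hasUnitaryLift_vacSection`, `vacSection_ne_zero`, and the equivariance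
  `vacSection_κ` (`vacSection γ (κ k) = W_K k`).

Use.  For the adelic theta majorants (`AdelicMetaplecticThetaMajorants.hasThetaMajorants_omega_comp`) the
archimedean input `Winf` need only be non-zero, strongly continuous and Heisenberg-covariant — exactly the exports
of §3; no archimedean splitting of the metaplectic cover and no vacuum-character datum is required.

Everything is PROVED from Mathlib and the imported tree files; no cited fact is a hypothesis.

## References

* [Folland1989] G. B. Folland, *Harmonic Analysis in Phase Space*, Annals of Mathematics Studies 122, Princeton
  University Press, 1989: §4.2, (4.23)–(4.24) and the Schur remark p. 156 (an operator intertwining `ρ(p,q)` with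
  `ρ(S(p,q))` is unique up to a scalar of modulus one); Prop. (4.39) (the action of `U(σ)` fixes the Gaussian)
  (doi:10.1515/9781400882427).
* [Knapp2002] A. W. Knapp, *Lie Groups Beyond an Introduction*, 2nd ed., Progress in Mathematics 140, Birkhäuser,
  2002: Theorem 7.39 (`G = KAK`), p. 457.
-/

noncomputable section

open MeasureTheory Complex SchwartzMap
open scoped InnerProductSpace ComplexConjugate Real

namespace Literature.NumberTheory.Weil1964

open Literature.Analysis.SegalBargmann Literature.RepresentationTheory.HeisenbergGroup

variable {σ : Type*} [Fintype σ] [DecidableEq σ]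

local notation "L2R" σ => Lp ℂ 2 (volume : Measure (σ → ℝ))
local notation "SR" σ => SchwartzMap (σ → ℝ) ℂ
local notation "PV" σ => (σ → ℝ) × (σ → ℝ)

/-- Notation (NOT a definition): `HasUnitaryLift[σ] A` abbreviates the (w2′) clause shape of
`IsArchWeilDatum.exists_lift` — `A : 𝓢 →ₗ 𝓢` is the restriction of SOME unitary operator of `L²(ℝ^σ)`. -/
local notation "HasUnitaryLift[" σ "]" A:max =>
  ∃ U : Lp ℂ 2 (volume : Measure (σ → ℝ)) ≃ₗᵢ[ℂ] Lp ℂ 2 (volume : Measure (σ → ℝ)),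
    LiftsTo A ((LinearIsometryEquiv.toContinuousLinearEquiv U :
        Lp ℂ 2 (volume : Measure (σ → ℝ)) ≃L[ℂ] Lp ℂ 2 (volume : Measure (σ → ℝ))) :
      Lp ℂ 2 (volume : Measure (σ → ℝ)) →L[ℂ] Lp ℂ 2 (volume : Measure (σ → ℝ)))

/-! ## 1. The vacuum coefficient and implementers of a single phase-space map -/

section Single

/-- The **vacuum coefficient** of an operator of `𝓢(ℝ^σ)`: `⟪k₀, toL2 (A h₀)⟫`, `h₀ = hermitePi 0` the Gaussian,
`k₀ = vacL2` its class in `L²`. [cite: Folland1989, §1.7; Prop. (4.39)] -/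
def vacCoeffS (A : (SR σ) →L[ℂ] SR σ) : ℂ := ⟪(vacL2 : L2R σ), toL2 (A (hermitePi 0))⟫_ℂ

/-- Unfolding `vacCoeffS`. [folklore] -/
theorem vacCoeffS_apply (A : (SR σ) →L[ℂ] SR σ) :
    vacCoeffS A = ⟪(vacL2 : L2R σ), toL2 (A (hermitePi 0))⟫_ℂ := rfl

/-- `vacCoeffS (c • A) = c * vacCoeffS A`. [folklore] -/
theorem vacCoeffS_smul (c : ℂ) (A : (SR σ) →L[ℂ] SR σ) : vacCoeffS (c • A) = c * vacCoeffS A := by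
  rw [vacCoeffS, vacCoeffS, smul_apply, map_smul, inner_smul_right]

/-- The vacuum coefficient of a family is continuous as soon as its Gaussian orbit is. [folklore] -/
theorem continuous_vacCoeffS {X : Type*} [TopologicalSpace X] {W : X → ((SR σ) →L[ℂ] SR σ)}
    (hW : Continuous fun x => W x (hermitePi 0)) : Continuous fun x => vacCoeffS (W x) :=
  Continuous.inner continuous_const (toL2.continuous.comp hW)

/-- The **vacuum normalisation** of an operator: the unimodular rescaling `(‖v‖ / v) • A`, `v = vacCoeffS A`, making the
vacuum coefficient real and positive (junk value `0` when `v = 0`). [cite: Folland1989, §4.2, the Schur remark p. 156] -/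
def vnormS (A : (SR σ) →L[ℂ] SR σ) : (SR σ) →L[ℂ] SR σ := ((‖vacCoeffS A‖ : ℂ) / vacCoeffS A) • A

/-- Unfolding `vnormS`. [folklore] -/
theorem vnormS_apply (A : (SR σ) →L[ℂ] SR σ) (f : SR σ) :
    vnormS A f = ((‖vacCoeffS A‖ : ℂ) / vacCoeffS A) • A f := rfl

/-- The normalising scalar is unimodular when the vacuum coefficient is non-zero. [folklore] -/
theorem norm_vnormS_scalar {A : (SR σ) →L[ℂ] SR σ} (hA : vacCoeffS A ≠ 0) :
    ‖((‖vacCoeffS A‖ : ℂ) / vacCoeffS A)‖ = 1 := by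
  rw [norm_div, Complex.norm_real, norm_norm, div_self (norm_ne_zero_iff.2 hA)]

/-- The vacuum coefficient of the normalisation is the positive real `‖vacCoeffS A‖`. [folklore] -/
theorem vacCoeffS_vnormS (A : (SR σ) →L[ℂ] SR σ) : vacCoeffS (vnormS A) = (‖vacCoeffS A‖ : ℂ) := by
  rw [vnormS, vacCoeffS_smul]
  by_cases h : vacCoeffS A = 0
  · rw [h, norm_zero, Complex.ofReal_zero, mul_zero]
  · rw [div_mul_cancel₀ _ h]

/-- Normalisation is blind to unimodular rescalings: `vnormS (c • A) = vnormS A` for `‖c‖ = 1`.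
[cite: Folland1989, §4.2, the Schur remark p. 156] -/
theorem vnormS_smul {c : ℂ} (hc : ‖c‖ = 1) (A : (SR σ) →L[ℂ] SR σ) : vnormS (c • A) = vnormS A := by
  have hc0 : c ≠ 0 := fun h => by rw [h, norm_zero] at hc; exact zero_ne_one hc
  rw [vnormS, vnormS, vacCoeffS_smul, norm_mul, hc, one_mul, smul_smul]
  congr 1
  by_cases h : vacCoeffS A = 0
  · simp [h]
  · field_simp

/-- An operator already normalised is its own normalisation. [folklore] -/
theorem vnormS_eq_self {A : (SR σ) →L[ℂ] SR σ} (hA : vacCoeffS A = (‖vacCoeffS A‖ : ℂ)) (hA0 : vacCoeffS A ≠ 0) :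
    vnormS A = A := by
  rw [vnormS, ← hA, div_self hA0, one_smul]

/-- **`A` implements the phase-space map `γ₀` on `𝓢(ℝ^σ)`**: Folland's relation (4.23)
`A ∘ ρ(p,q) = ρ(γ₀(p,q)) ∘ A` for ONE operator, together with (w2′): `A` is the restriction of a unitary operator
of `L²(ℝ^σ)`. [cite: Folland1989, §4.2, (4.23) p. 156] -/
def IsImplementerS (γ₀ : PhaseMap σ) (A : (SR σ) →L[ℂ] SR σ) : Prop :=
  (∀ (p q : σ → ℝ) (f : SR σ), A (rhoS p q f) = rhoS (γ₀ (p, q)).1 (γ₀ (p, q)).2 (A f)) ∧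
    HasUnitaryLift[σ] ((A : (SR σ) →L[ℂ] SR σ) : (SR σ) →ₗ[ℂ] SR σ)

namespace IsImplementerS

omit [DecidableEq σ] in
/-- An implementer, seen as a one-member covariant family (index type `Unit`). [folklore] -/
theorem isPhaseCovariantS {γ₀ : PhaseMap σ} {A : (SR σ) →L[ℂ] SR σ} (hA : IsImplementerS γ₀ A) :
    IsPhaseCovariantS (fun _ : Unit => γ₀) (fun _ => ((A : (SR σ) →L[ℂ] SR σ) : (SR σ) →ₗ[ℂ] SR σ)) :=
  fun _ p q f => by simpa only [ContinuousLinearMap.coe_coe] using hA.1 p q f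

/-- **Schur for implementers**: two implementers of the same phase-space map differ by a unimodular scalar.
[cite: Folland1989, §4.2, the Schur remark p. 156] -/
theorem exists_eq_smul {γ₀ : PhaseMap σ} {A A' : (SR σ) →L[ℂ] SR σ} (hA : IsImplementerS γ₀ A)
    (hA' : IsImplementerS γ₀ A') : ∃ c : ℂ, ‖c‖ = 1 ∧ A' = c • A := by
  obtain ⟨U, hU⟩ := hA.2
  obtain ⟨U', hU'⟩ := hA'.2
  have hl : ∀ x : Unit, LiftsTo ((A : (SR σ) →L[ℂ] SR σ) : (SR σ) →ₗ[ℂ] SR σ) (liftCLM (fun _ : Unit => U) x) :=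
    fun _ => hU
  have hl' : ∀ x : Unit, LiftsTo ((A' : (SR σ) →L[ℂ] SR σ) : (SR σ) →ₗ[ℂ] SR σ) (liftCLM (fun _ : Unit => U') x) :=
    fun _ => hU'
  refine ⟨relCoeff (fun _ : Unit => U) (fun _ => U') (), norm_relCoeff_of_liftsTo hA.isPhaseCovariantS
    hA'.isPhaseCovariantS hl hl' (), ?_⟩
  refine ContinuousLinearMap.ext fun f => ?_
  have h1 := eq_relCoeff_smul_of_liftsTo hA.isPhaseCovariantS hA'.isPhaseCovariantS hl hl' () f
  simpa only [ContinuousLinearMap.coe_coe, smul_apply] using h1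

omit [DecidableEq σ] in
/-- A unimodular multiple of a unitary is a unitary: the scalar isometry of `L²`. [folklore] -/
theorem exists_smul_linearIsometryEquiv {c : ℂ} (hc : ‖c‖ = 1) (U : (L2R σ) ≃ₗᵢ[ℂ] L2R σ) :
    ∃ V : (L2R σ) ≃ₗᵢ[ℂ] L2R σ, ∀ x, V x = c • U x := by
  have hc0 : c ≠ 0 := fun h => by rw [h, norm_zero] at hc; exact zero_ne_one hc
  refine ⟨U.trans
    { toLinearEquiv := LinearEquiv.smulOfNeZero ℂ (L2R σ) c hc0
      norm_map' := fun x => ?_ }, fun x => rfl⟩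
  show ‖c • x‖ = ‖x‖
  rw [norm_smul, hc, one_mul]

omit [DecidableEq σ] in
/-- Unimodular rescaling preserves implementers. [cite: Folland1989, §4.2, the Schur remark p. 156] -/
theorem smul {γ₀ : PhaseMap σ} {A : (SR σ) →L[ℂ] SR σ} (hA : IsImplementerS γ₀ A) {c : ℂ} (hc : ‖c‖ = 1) :
    IsImplementerS γ₀ (c • A) := by
  refine ⟨fun p q f => ?_, ?_⟩
  · rw [smul_apply, smul_apply, hA.1 p q f, map_smul]
  · obtain ⟨U, hU⟩ := hA.2
    obtain ⟨V, hV⟩ := exists_smul_linearIsometryEquiv hc U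
    refine ⟨V, fun f => ?_⟩
    have h1 := hU f
    simp only [ContinuousLinearMap.coe_coe, ContinuousLinearEquiv.coe_coe,
      LinearIsometryEquiv.coe_toContinuousLinearEquiv] at h1 ⊢
    rw [hV, smul_apply, map_smul, h1]

omit [DecidableEq σ] in
/-- Implementers compose: `A ∘ B` implements `γ₁ ∘ γ₂`. [cite: Folland1989, §4.2, (4.24)] -/
theorem comp {γ₁ γ₂ : PhaseMap σ} {A B : (SR σ) →L[ℂ] SR σ} (hA : IsImplementerS γ₁ A) (hB : IsImplementerS γ₂ B) :
    IsImplementerS (γ₁ ∘ γ₂) (A.comp B) := by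
  refine ⟨fun p q f => ?_, ?_⟩
  · rw [ContinuousLinearMap.comp_apply, ContinuousLinearMap.comp_apply, hB.1 p q f, hA.1]
    rfl
  · obtain ⟨U, hU⟩ := hA.2
    obtain ⟨V, hV⟩ := hB.2
    refine ⟨V.trans U, fun f => ?_⟩
    have h1 := hU (B f)
    have h2 := hV f
    simp only [ContinuousLinearMap.coe_coe, ContinuousLinearEquiv.coe_coe,
      LinearIsometryEquiv.coe_toContinuousLinearEquiv] at h1 h2 ⊢
    rw [ContinuousLinearMap.comp_apply, h1, h2, LinearIsometryEquiv.trans_apply]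

/-- The vacuum normalisation of an implementer with non-zero vacuum coefficient is an implementer.
[cite: Folland1989, §4.2, the Schur remark p. 156] -/
theorem vnormS {γ₀ : PhaseMap σ} {A : (SR σ) →L[ℂ] SR σ} (hA : IsImplementerS γ₀ A) (hA0 : vacCoeffS A ≠ 0) :
    IsImplementerS γ₀ (vnormS A) :=
  hA.smul (norm_vnormS_scalar hA0)

/-- Two implementers of the same map have the same normalisation. [cite: Folland1989, §4.2, the Schur remark p. 156] -/
theorem vnormS_eq {γ₀ : PhaseMap σ} {A A' : (SR σ) →L[ℂ] SR σ} (hA : IsImplementerS γ₀ A)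
    (hA' : IsImplementerS γ₀ A') : Literature.NumberTheory.Weil1964.vnormS A' = Literature.NumberTheory.Weil1964.vnormS A := by
  obtain ⟨c, hc, rfl⟩ := hA.exists_eq_smul hA'
  exact vnormS_smul hc A

/-- … and vacuum coefficients of the same modulus; in particular they vanish together.
[cite: Folland1989, §4.2, the Schur remark p. 156] -/
theorem norm_vacCoeffS_eq {γ₀ : PhaseMap σ} {A A' : (SR σ) →L[ℂ] SR σ} (hA : IsImplementerS γ₀ A)
    (hA' : IsImplementerS γ₀ A') : ‖vacCoeffS A'‖ = ‖vacCoeffS A‖ := by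
  obtain ⟨c, hc, rfl⟩ := hA.exists_eq_smul hA'
  rw [vacCoeffS_smul, norm_mul, hc, one_mul]

omit [DecidableEq σ] in
/-- An implementer kills no non-zero Schwartz function. [folklore] -/
theorem apply_ne_zero {γ₀ : PhaseMap σ} {A : (SR σ) →L[ℂ] SR σ} (hA : IsImplementerS γ₀ A) {f : SR σ}
    (hf : f ≠ 0) : A f ≠ 0 := by
  obtain ⟨U, hU⟩ := hA.2
  have h1 := ne_zero_of_liftsTo hU hf
  simpa only [ContinuousLinearMap.coe_coe] using h1

end IsImplementerS

/-- **A vacuum-fixing implementer preserves vacuum coefficients on both sides**: if `W h₀ = h₀` then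
`vacCoeffS (W ∘ X ∘ W′) = vacCoeffS X` for any second vacuum-fixing implementer `W′`.
[cite: Folland1989, Prop. (4.39)] -/
theorem vacCoeffS_comp_comp {γ₁ γ₂ : PhaseMap σ} {W W' X : (SR σ) →L[ℂ] SR σ} (hW : IsImplementerS γ₁ W)
    (hWvac : W (hermitePi 0) = hermitePi 0) (_hW' : IsImplementerS γ₂ W') (hW'vac : W' (hermitePi 0) = hermitePi 0) :
    vacCoeffS ((W.comp X).comp W') = vacCoeffS X := by
  obtain ⟨U, hU⟩ := hW.2
  have hU' : ∀ f : SR σ, toL2 (W f) = U (toL2 f) := fun f => by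
    have h1 := hU f
    simpa only [ContinuousLinearMap.coe_coe, ContinuousLinearEquiv.coe_coe,
      LinearIsometryEquiv.coe_toContinuousLinearEquiv] using h1
  have hUvac : U (vacL2 : L2R σ) = vacL2 := by
    rw [← toL2_hermitePi_zero, ← hU', hWvac]
  have key : ∀ y : L2R σ, ⟪(vacL2 : L2R σ), U y⟫_ℂ = ⟪(vacL2 : L2R σ), y⟫_ℂ := fun y => by
    conv_lhs => rw [← hUvac]
    exact U.inner_map_map _ _
  rw [vacCoeffS, vacCoeffS, ContinuousLinearMap.comp_apply, ContinuousLinearMap.comp_apply, hW'vac, hU', key]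

/-- A vacuum-fixing implementer has vacuum coefficient `‖k₀‖² = 1 > 0`… precisely: it equals `⟪k₀, k₀⟫`, a non-zero
real. [cite: Folland1989, Prop. (4.39)] -/
theorem vacCoeffS_of_apply_hermitePi_zero {W : (SR σ) →L[ℂ] SR σ} (hWvac : W (hermitePi 0) = hermitePi 0) :
    vacCoeffS W = ((‖(vacL2 : L2R σ)‖ ^ 2 : ℝ) : ℂ) := by
  rw [vacCoeffS, hWvac, toL2_hermitePi_zero, inner_self_eq_norm_sq_to_K]
  norm_cast

omit [Fintype σ] [DecidableEq σ] in
/-- `‖k₀‖² ≠ 0`. [folklore] -/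
theorem vacL2_norm_sq_ne_zero [Fintype σ] : ((‖(vacL2 : L2R σ)‖ ^ 2 : ℝ) : ℂ) ≠ 0 := by
  exact_mod_cast pow_ne_zero 2 (norm_ne_zero_iff.2 vacL2_ne_zero)

end Single

/-! ## 2. The section: definition and uniqueness -/

section Section_

variable {G : Type*}

open Classical in
/-- **The vacuum-normalised implementer section.**  For `γ : G → PhaseMap σ` and `g : G`: the vacuum normalisation
of ANY implementer of `γ g` with non-zero vacuum coefficient (they all have the same normalisation, by Schur);
junk value `0` if there is none. [cite: Folland1989, §4.2, the Schur remark p. 156] -/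
def vacSection (γ : G → PhaseMap σ) (g : G) : (SR σ) →L[ℂ] SR σ :=
  if h : ∃ A : (SR σ) →L[ℂ] SR σ, IsImplementerS (γ g) A ∧ vacCoeffS A ≠ 0 then vnormS h.choose else 0

/-- **Uniqueness**: every implementer of `γ g` with non-zero vacuum coefficient normalises to `vacSection γ g`.
[cite: Folland1989, §4.2, the Schur remark p. 156] -/
theorem vacSection_eq_vnormS {γ : G → PhaseMap σ} {g : G} {A : (SR σ) →L[ℂ] SR σ} (hA : IsImplementerS (γ g) A)
    (hA0 : vacCoeffS A ≠ 0) : vacSection γ g = vnormS A := by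
  have h : ∃ A : (SR σ) →L[ℂ] SR σ, IsImplementerS (γ g) A ∧ vacCoeffS A ≠ 0 := ⟨A, hA, hA0⟩
  rw [vacSection, dif_pos h]
  exact hA.vnormS_eq h.choose_spec.1

/-- `vacSection γ g` is an implementer of `γ g` (as soon as one with non-zero vacuum coefficient exists).
[cite: Folland1989, §4.2, (4.23) p. 156] -/
theorem isImplementerS_vacSection {γ : G → PhaseMap σ} {g : G} {A : (SR σ) →L[ℂ] SR σ} (hA : IsImplementerS (γ g) A)
    (hA0 : vacCoeffS A ≠ 0) : IsImplementerS (γ g) (vacSection γ g) := by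
  rw [vacSection_eq_vnormS hA hA0]
  exact hA.vnormS hA0

/-- Its vacuum coefficient is the positive real `‖vacCoeffS A‖`, the same for every implementer `A`.
[cite: Folland1989, §4.2, the Schur remark p. 156] -/
theorem vacCoeffS_vacSection {γ : G → PhaseMap σ} {g : G} {A : (SR σ) →L[ℂ] SR σ} (hA : IsImplementerS (γ g) A)
    (hA0 : vacCoeffS A ≠ 0) : vacCoeffS (vacSection γ g) = (‖vacCoeffS A‖ : ℂ) := by
  rw [vacSection_eq_vnormS hA hA0, vacCoeffS_vnormS]

/-- … in particular non-zero, real and positive. [cite: Folland1989, §4.2, the Schur remark p. 156] -/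
theorem vacCoeffS_vacSection_ne_zero {γ : G → PhaseMap σ} {g : G} {A : (SR σ) →L[ℂ] SR σ}
    (hA : IsImplementerS (γ g) A) (hA0 : vacCoeffS A ≠ 0) : vacCoeffS (vacSection γ g) ≠ 0 := by
  rw [vacCoeffS_vacSection hA hA0]
  exact_mod_cast norm_ne_zero_iff.2 hA0

/-- The normalisation is idempotent on the section. [folklore] -/
theorem vacCoeffS_vacSection_eq_norm {γ : G → PhaseMap σ} {g : G} {A : (SR σ) →L[ℂ] SR σ}
    (hA : IsImplementerS (γ g) A) (hA0 : vacCoeffS A ≠ 0) :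
    vacCoeffS (vacSection γ g) = (‖vacCoeffS (vacSection γ g)‖ : ℂ) := by
  rw [vacCoeffS_vacSection hA hA0, Complex.norm_real, norm_norm]

/-- **Characterisation**: an implementer of `γ g` whose vacuum coefficient is real and positive IS `vacSection γ g`.
[cite: Folland1989, §4.2, the Schur remark p. 156] -/
theorem eq_vacSection {γ : G → PhaseMap σ} {g : G} {A : (SR σ) →L[ℂ] SR σ} (hA : IsImplementerS (γ g) A)
    (hApos : vacCoeffS A = (‖vacCoeffS A‖ : ℂ)) (hA0 : vacCoeffS A ≠ 0) : A = vacSection γ g := by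
  rw [vacSection_eq_vnormS hA hA0, vnormS_eq_self hApos hA0]

/-- The section kills no non-zero Schwartz function. [folklore] -/
theorem vacSection_apply_ne_zero {γ : G → PhaseMap σ} {g : G} {A : (SR σ) →L[ℂ] SR σ} (hA : IsImplementerS (γ g) A)
    (hA0 : vacCoeffS A ≠ 0) {f : SR σ} (hf : f ≠ 0) : vacSection γ g f ≠ 0 :=
  (isImplementerS_vacSection hA hA0).apply_ne_zero hf

/- From here on `vacSection` is only used through the lemmas above. -/
attribute [irreducible] vacSection

end Section_

/-! ## 3. The section of a `KAK` group: existence everywhere, the formula on words, joint continuity -/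

section KAK

variable {G : Type*} [Monoid G] [TopologicalSpace G] {K : Type*} [TopologicalSpace K] {P : Type*} [TopologicalSpace P]

/-- **The `KAK` implementer data** over phase-space maps `γ : G → PhaseMap σ` compatible with multiplication:
(K) a map `κ : K → G` and an explicit family `W_K` of implementers of `γ (κ k)` FIXING the Gaussian, jointly continuous;
(A) a map `a : P → G` and an explicit family `W_A` of implementers of `γ (a t)` with NON-VANISHING vacuum
coefficients, jointly continuous; (M) `(k₁, t, k₂) ↦ κ k₁ · a t · κ k₂` a proper surjection.  (A structure of
HYPOTHESES only — every field is discharged by a theorem at each instance; nothing is cited.)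
[cite: Folland1989, §4.2 p. 156, Prop. (4.39); Knapp2002, Thm 7.39] -/
structure KAKImplementerData (γ : G → PhaseMap σ) (κ : K → G) (a : P → G) (WK : K → ((SR σ) →L[ℂ] SR σ))
    (WA : P → ((SR σ) →L[ℂ] SR σ)) : Prop where
  map_mul : ∀ g g' pq, γ (g * g') pq = γ g (γ g' pq)
  implK : ∀ k, IsImplementerS (γ (κ k)) (WK k)
  vacK : ∀ k, WK k (hermitePi 0) = hermitePi 0
  contK : Continuous fun x : K × SR σ => WK x.1 x.2
  implA : ∀ t, IsImplementerS (γ (a t)) (WA t)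
  vacA : ∀ t, vacCoeffS (WA t) ≠ 0
  contA : Continuous fun x : P × SR σ => WA x.1 x.2
  isProperMap : IsProperMap fun p : K × P × K => κ p.1 * a p.2.1 * κ p.2.2
  surjective : Function.Surjective fun p : K × P × K => κ p.1 * a p.2.1 * κ p.2.2

namespace KAKImplementerData

variable {γ : G → PhaseMap σ} {κ : K → G} {a : P → G} {WK : K → ((SR σ) →L[ℂ] SR σ)}
  {WA : P → ((SR σ) →L[ℂ] SR σ)}

/-- The word operator `W_K k₁ ∘ W_A t ∘ W_K k₂` implements `γ (κ k₁ · a t · κ k₂)`. [cite: Folland1989, §4.2, (4.24)] -/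
theorem isImplementerS_word (D : KAKImplementerData γ κ a WK WA) (k₁ : K) (t : P) (k₂ : K) :
    IsImplementerS (γ (κ k₁ * a t * κ k₂)) (((WK k₁).comp (WA t)).comp (WK k₂)) := by
  have h1 := ((D.implK k₁).comp (D.implA t)).comp (D.implK k₂)
  have hγ : γ (κ k₁ * a t * κ k₂) = (γ (κ k₁) ∘ γ (a t)) ∘ γ (κ k₂) := by
    funext pq
    rw [D.map_mul, D.map_mul]
    rfl
  rw [hγ]
  exact h1

/-- Its vacuum coefficient is that of `W_A t`. [cite: Folland1989, Prop. (4.39)] -/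
theorem vacCoeffS_word (D : KAKImplementerData γ κ a WK WA) (k₁ : K) (t : P) (k₂ : K) :
    vacCoeffS (((WK k₁).comp (WA t)).comp (WK k₂)) = vacCoeffS (WA t) :=
  vacCoeffS_comp_comp (D.implK k₁) (D.vacK k₁) (D.implK k₂) (D.vacK k₂)

/-- **Existence everywhere**: every `γ g` has an implementer with non-zero vacuum coefficient.
[cite: Folland1989, §4.2 p. 156; Knapp2002, Thm 7.39] -/
theorem exists_isImplementerS (D : KAKImplementerData γ κ a WK WA) (g : G) :
    ∃ A : (SR σ) →L[ℂ] SR σ, IsImplementerS (γ g) A ∧ vacCoeffS A ≠ 0 := by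
  obtain ⟨⟨k₁, t, k₂⟩, rfl⟩ := D.surjective g
  exact ⟨_, D.isImplementerS_word k₁ t k₂, by rw [D.vacCoeffS_word]; exact D.vacA t⟩

/-- `vacSection γ g` implements `γ g`, for every `g`. [cite: Folland1989, §4.2, (4.23) p. 156] -/
theorem isImplementerS_vacSection (D : KAKImplementerData γ κ a WK WA) (g : G) :
    IsImplementerS (γ g) (vacSection γ g) := by
  obtain ⟨A, hA, hA0⟩ := D.exists_isImplementerS g
  exact Literature.NumberTheory.Weil1964.isImplementerS_vacSection hA hA0

/-- **(w2) Heisenberg covariance of the section.** [cite: Folland1989, §4.2, (4.23) p. 156] -/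
theorem isPhaseCovariantS_vacSection (D : KAKImplementerData γ κ a WK WA) :
    IsPhaseCovariantS γ (fun g => ((vacSection γ g : (SR σ) →L[ℂ] SR σ) : (SR σ) →ₗ[ℂ] SR σ)) :=
  fun g p q f => by simpa only [ContinuousLinearMap.coe_coe] using (D.isImplementerS_vacSection g).1 p q f

/-- **(w2′) unitary lifts of the section.** [cite: Folland1989, §4.2 p. 156] -/
theorem hasUnitaryLift_vacSection (D : KAKImplementerData γ κ a WK WA) (g : G) :
    HasUnitaryLift[σ] ((vacSection γ g : (SR σ) →L[ℂ] SR σ) : (SR σ) →ₗ[ℂ] SR σ) :=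
  (D.isImplementerS_vacSection g).2

/-- The vacuum coefficient of the section is a non-zero (positive real) number. [cite: Folland1989, §4.2 p. 156] -/
theorem vacCoeffS_vacSection_ne_zero (D : KAKImplementerData γ κ a WK WA) (g : G) : vacCoeffS (vacSection γ g) ≠ 0 := by
  obtain ⟨A, hA, hA0⟩ := D.exists_isImplementerS g
  exact Literature.NumberTheory.Weil1964.vacCoeffS_vacSection_ne_zero hA hA0

/-- … and real positive: `vacCoeffS (vacSection γ g) = ‖vacCoeffS (vacSection γ g)‖`. [cite: Folland1989, §4.2 p. 156] -/
theorem vacCoeffS_vacSection_eq_norm (D : KAKImplementerData γ κ a WK WA) (g : G) :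
    vacCoeffS (vacSection γ g) = (‖vacCoeffS (vacSection γ g)‖ : ℂ) := by
  obtain ⟨A, hA, hA0⟩ := D.exists_isImplementerS g
  exact Literature.NumberTheory.Weil1964.vacCoeffS_vacSection_eq_norm hA hA0

/-- **(w0)** the section kills no non-zero Schwartz function … [folklore] -/
theorem vacSection_apply_ne_zero (D : KAKImplementerData γ κ a WK WA) (g : G) {f : SR σ} (hf : f ≠ 0) :
    vacSection γ g f ≠ 0 :=
  (D.isImplementerS_vacSection g).apply_ne_zero hf

/-- … so it is a non-zero operator. [folklore] -/
theorem vacSection_ne_zero (D : KAKImplementerData γ κ a WK WA) (g : G) : vacSection γ g ≠ 0 := by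
  intro h0
  apply D.vacSection_apply_ne_zero g hermitePi_zero_ne_zero
  rw [h0, zero_apply]

/-- **The formula on words**: `vacSection γ (κ k₁ · a t · κ k₂) = (‖v‖/v) • W_K k₁ ∘ W_A t ∘ W_K k₂`, `v = vacCoeffS (W_A t)`.
[cite: Folland1989, §4.2, the Schur remark p. 156; Prop. (4.39)] -/
theorem vacSection_kak (D : KAKImplementerData γ κ a WK WA) (k₁ : K) (t : P) (k₂ : K) :
    vacSection γ (κ k₁ * a t * κ k₂) =
      ((‖vacCoeffS (WA t)‖ : ℂ) / vacCoeffS (WA t)) • ((WK k₁).comp (WA t)).comp (WK k₂) := by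
  rw [vacSection_eq_vnormS (D.isImplementerS_word k₁ t k₂) (by rw [D.vacCoeffS_word]; exact D.vacA t), vnormS,
    D.vacCoeffS_word]

/-- The same, applied to a Schwartz function. [cite: Folland1989, §4.2, the Schur remark p. 156] -/
theorem vacSection_kak_apply (D : KAKImplementerData γ κ a WK WA) (k₁ : K) (t : P) (k₂ : K) (f : SR σ) :
    vacSection γ (κ k₁ * a t * κ k₂) f =
      ((‖vacCoeffS (WA t)‖ : ℂ) / vacCoeffS (WA t)) • WK k₁ (WA t (WK k₂ f)) := by
  rw [D.vacSection_kak]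
  rfl

/-- The normalising scalar `t ↦ ‖v(t)‖/v(t)` is continuous on `P`. [folklore] -/
theorem continuous_scalar (D : KAKImplementerData γ κ a WK WA) :
    Continuous fun t : P => (‖vacCoeffS (WA t)‖ : ℂ) / vacCoeffS (WA t) := by
  have hv : Continuous fun t : P => vacCoeffS (WA t) :=
    continuous_vacCoeffS (D.contA.comp (continuous_id.prodMk continuous_const))
  exact (Complex.continuous_ofReal.comp (continuous_norm.comp hv)).div hv D.vacA

/-- Joint continuity of the section along the `KAK` map. [folklore] -/
theorem continuous_uncurry_vacSection_kak (D : KAKImplementerData γ κ a WK WA) :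
    Continuous fun x : (K × P × K) × SR σ => vacSection γ (κ x.1.1 * a x.1.2.1 * κ x.1.2.2) x.2 := by
  have hformula : (fun x : (K × P × K) × SR σ => vacSection γ (κ x.1.1 * a x.1.2.1 * κ x.1.2.2) x.2) =
      fun x => ((‖vacCoeffS (WA x.1.2.1)‖ : ℂ) / vacCoeffS (WA x.1.2.1)) • WK x.1.1 (WA x.1.2.1 (WK x.1.2.2 x.2)) :=
    funext fun x => D.vacSection_kak_apply x.1.1 x.1.2.1 x.1.2.2 x.2
  rw [hformula]
  refine (D.continuous_scalar.comp (continuous_fst.comp (continuous_snd.comp continuous_fst))).smul ?_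
  have h3 : Continuous fun x : (K × P × K) × SR σ => WK x.1.2.2 x.2 :=
    D.contK.comp ((continuous_snd.comp (continuous_snd.comp continuous_fst)).prodMk continuous_snd)
  have h2 : Continuous fun x : (K × P × K) × SR σ => WA x.1.2.1 (WK x.1.2.2 x.2) :=
    D.contA.comp ((continuous_fst.comp (continuous_snd.comp continuous_fst)).prodMk h3)
  exact D.contK.comp ((continuous_fst.comp continuous_fst).prodMk h2)

/-- **(w1) joint form: `(g, f) ↦ vacSection γ g f` is continuous `G × 𝓢(ℝ^σ) → 𝓢(ℝ^σ)`** — descent along the proper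
surjection `K × P × K → G`. [cite: Folland1989, §4.2, the Schur remark p. 156; Knapp2002, Thm 7.39] -/
theorem continuous_uncurry_vacSection (D : KAKImplementerData γ κ a WK WA) :
    Continuous fun x : G × SR σ => vacSection γ x.1 x.2 :=
  continuous_uncurry_of_isProperMap D.isProperMap D.surjective (F := fun g f => vacSection γ g f)
    D.continuous_uncurry_vacSection_kak

/-- **(w1)**: every orbit map `g ↦ vacSection γ g f` is continuous into `𝓢(ℝ^σ)`. [cite: Folland1989, §4.2 p. 156] -/
theorem continuous_apply_vacSection (D : KAKImplementerData γ κ a WK WA) (f : SR σ) :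
    Continuous fun g => vacSection γ g f := by
  have h1 : Continuous fun g : G => ((g, f) : G × SR σ) := continuous_id.prodMk continuous_const
  exact D.continuous_uncurry_vacSection.comp h1

/-- **On the compact part the section IS `W_K`**: `vacSection γ (κ k) = W_K k` (the vacuum-fixing implementer has
vacuum coefficient `‖k₀‖² > 0`). [cite: Folland1989, Prop. (4.39)] -/
theorem vacSection_κ (D : KAKImplementerData γ κ a WK WA) (k : K) : vacSection γ (κ k) = WK k := by
  have hv := vacCoeffS_of_apply_hermitePi_zero (D.vacK k)
  have hv0 : vacCoeffS (WK k) ≠ 0 := by rw [hv]; exact vacL2_norm_sq_ne_zero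
  refine (eq_vacSection (D.implK k) ?_ hv0).symm
  rw [hv]
  norm_cast
  rw [Real.norm_of_nonneg (sq_nonneg _)]

/-- **Bi-equivariance under the compact part**: `vacSection γ (κ k₁ · g · κ k₂) = W_K k₁ ∘ vacSection γ g ∘ W_K k₂`.
[cite: Folland1989, §4.2, the Schur remark p. 156; Prop. (4.39)] -/
theorem vacSection_κ_mul_mul_κ (D : KAKImplementerData γ κ a WK WA) (k₁ : K) (g : G) (k₂ : K) :
    vacSection γ (κ k₁ * g * κ k₂) = ((WK k₁).comp (vacSection γ g)).comp (WK k₂) := by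
  have hI : IsImplementerS (γ (κ k₁ * g * κ k₂)) (((WK k₁).comp (vacSection γ g)).comp (WK k₂)) := by
    have h1 := ((D.implK k₁).comp (D.isImplementerS_vacSection g)).comp (D.implK k₂)
    have hγ : γ (κ k₁ * g * κ k₂) = (γ (κ k₁) ∘ γ g) ∘ γ (κ k₂) := by
      funext pq
      rw [D.map_mul, D.map_mul]
      rfl
    rw [hγ]
    exact h1
  have hv : vacCoeffS (((WK k₁).comp (vacSection γ g)).comp (WK k₂)) = vacCoeffS (vacSection γ g) :=
    vacCoeffS_comp_comp (D.implK k₁) (D.vacK k₁) (D.implK k₂) (D.vacK k₂)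
  refine (eq_vacSection hI ?_ ?_).symm
  · rw [hv]
    exact D.vacCoeffS_vacSection_eq_norm g
  · rw [hv]
    exact D.vacCoeffS_vacSection_ne_zero g

end KAKImplementerData

/-! ### The data with (K) discharged by Folland's `μ₀ = unitaryOpPi` -/

omit [Monoid G] [TopologicalSpace G] [TopologicalSpace K] [TopologicalSpace P] in
/-- `unitaryOpPi (ιK k)` implements `realify (ιK k)` — hence `γ (κ k)` whenever the latter is that real map.
[cite: Folland1989, Prop. (4.39)] -/
theorem isImplementerS_unitaryOpPi {γ : G → PhaseMap σ} {κ : K → G} (ιK : K → Matrix.unitaryGroup σ ℂ)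
    (hreal : ∀ k pq, γ (κ k) pq = realify (ιK k) pq) (k : K) : IsImplementerS (γ (κ k)) (unitaryOpPi (ιK k)) := by
  refine ⟨fun p q f => ?_, ⟨_, liftsTo_unitaryOpPi (ιK k)⟩⟩
  have h1 := (isRhoCovariantS_unitaryOpPi ιK) k p q f
  simp only [ContinuousLinearMap.coe_coe] at h1
  rw [hreal k (p, q)]
  exact h1

/-- **The `KAK` implementer data with the compact part implemented by `μ₀`**: `W_K k := unitaryOpPi (ιK k)` for a
continuous `ιK : K → U(σ)` realising `γ ∘ κ`; it fixes the Gaussian (`unitaryOpPi_hermitePi_zero`) and is jointly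
continuous (`continuous_unitaryOpPi_uncurry`). [cite: Folland1989, Prop. (4.39); Knapp2002, Thm 7.39] -/
theorem kakImplementerData_unitaryOpPi {γ : G → PhaseMap σ} (hγ : ∀ g g' pq, γ (g * g') pq = γ g (γ g' pq))
    {κ : K → G} (ιK : K → Matrix.unitaryGroup σ ℂ) (hιK : Continuous ιK)
    (hreal : ∀ k pq, γ (κ k) pq = realify (ιK k) pq) {a : P → G} {WA : P → ((SR σ) →L[ℂ] SR σ)}
    (hWA : ∀ t, IsImplementerS (γ (a t)) (WA t)) (hWAvac : ∀ t, vacCoeffS (WA t) ≠ 0)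
    (hWAc : Continuous fun x : P × SR σ => WA x.1 x.2)
    (hm : IsProperMap fun p : K × P × K => κ p.1 * a p.2.1 * κ p.2.2)
    (hsurj : Function.Surjective fun p : K × P × K => κ p.1 * a p.2.1 * κ p.2.2) :
    KAKImplementerData γ κ a (fun k => unitaryOpPi (ιK k)) WA where
  map_mul := hγ
  implK := isImplementerS_unitaryOpPi ιK hreal
  vacK k := unitaryOpPi_hermitePi_zero (ιK k)
  contK := continuous_unitaryOpPi_uncurry.comp (f := fun x : K × (SR σ) => (ιK x.1, x.2))
    ((hιK.comp continuous_fst).prodMk continuous_snd)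
  implA := hWA
  vacA := hWAvac
  contA := hWAc
  isProperMap := hm
  surjective := hsurj

omit [DecidableEq σ] [Monoid G] [TopologicalSpace G] [TopologicalSpace K] [TopologicalSpace P] in
/-- An implementer family in the tree's (w2)+(w2′) family currency gives implementers pointwise. [folklore] -/
theorem isImplementerS_of_isPhaseCovariantS {X : Type*} {γX : X → PhaseMap σ} {W : X → ((SR σ) →L[ℂ] SR σ)}
    (hW : IsPhaseCovariantS γX (fun x => ((W x : (SR σ) →L[ℂ] SR σ) : (SR σ) →ₗ[ℂ] SR σ)))
    (hWl : ∀ x, HasUnitaryLift[σ] ((W x : (SR σ) →L[ℂ] SR σ) : (SR σ) →ₗ[ℂ] SR σ)) (x : X) :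
    IsImplementerS (γX x) (W x) :=
  ⟨fun p q f => by simpa only [ContinuousLinearMap.coe_coe] using hW x p q f, hWl x⟩

end KAK

end Literature.NumberTheory.Weil1964
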